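import Literature.AlgebraicGeometry.Frobenioids.TwoLevelFrobenioidClauses
import HarnessLib

/-!
# The two-level Frobenioid over `B(ℤ/2)` IS a Frobenioid: Definition 1.3, clauses (iv)–(vii), assembly

Mochizuki, *The geometry of Frobenioids I: the general theory*, Kyushu J. Math. **62** (2008)
293–400, §1, Definition 1.3 pp. 24–25 [cite: MochizukiFrdI2008, Def. 1.3 p.24] — verified for OUR
two-object test category `C → F_Φ` of `TwoLevelFrobenioid.lean` (finding F-t8g2-1 of the abc-iut
cell; not a construction of the paper): clauses (iv)(a)(b), (v)(a)(b)(c), (vi), (vii)(a)(b), and the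
assembled `TwoLevel.isFrobenioid : IsFrobenioid toElem` (axioms: propext, Classical.choice,
Quot.sound).  With `TwoLevelFrobenioidMorphisms.lean` this gives a kernel-checked Frobenioid having an
object (`low`) that is metrically trivial and Frobenius-ample but neither isotropic nor `Aut`-ample.
Nothing here bears on [IUTchIII].
-/

namespace Literature.AlgebraicGeometry.Frobenioids

open CategoryTheory Opposite

namespace TwoLevel

open PreFrobenioid

/-! ### Definition 1.3 (iv) -/

/-- (iv)(a), existence: `φ = (Frobenius (1,0,n)) ≫ (pre-step (g,z,1)) ≫ id`, or `id ≫ φ ≫ id` when `φ`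
is linear. [cite: MochizukiFrdI2008, Def. 1.3(iv) p.25] -/
theorem iv_a_exists {A B : Obj} (φ : A ⟶ B) :
    ∃ (X Y : Obj) (γ : A ⟶ X) (β : X ⟶ Y) (α : Y ⟶ B), γ ≫ β ≫ α = φ ∧ IsFrobeniusType toElem γ ∧
      IsPreStep toElem β ∧ IsPullbackMorphism toElem α := by
  by_cases hlin : dg φ.1 = 1
  · refine ⟨A, B, 𝟙 A, φ, 𝟙 B, by simp, (isFrobeniusType_iff _).mpr ⟨rfl, ?_⟩, (isPreStep_iff _).mpr hlin,
      isPullbackMorphism_of_isIso toElem _⟩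
    rintro ⟨h1, h2, -⟩; exact Obj.noConfusion (h1.symm.trans h2)
  · cases B
    · cases A
      · exact (hlin (dg_low φ)).elim
      · exact (no_top_low φ).elim
    · refine ⟨Obj.top, Obj.top, toTop A 1 1 (dg φ.1), toTop Obj.top (bs φ.1) (dv φ.1) 1, 𝟙 _, ?_,
        isFrobeniusType_toTop 1 _ (Or.inr hlin), (isPreStep_iff _).mpr rfl, isPullbackMorphism_of_isIso toElem _⟩
      exact hom_ext (E_ext (by simp) (by simp) (by simp))

/-- (iv)(a), uniqueness up to isomorphisms of the middle objects (pull-backs are invertible; the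
Frobenius parts are compared by (ii); the middle square by cancelling the epimorphism `γ`).
[cite: MochizukiFrdI2008, Def. 1.3(iv) p.25] -/
theorem iv_a_unique {A B X Y X' Y' : Obj} (φ : A ⟶ B) (γ : A ⟶ X) (β : X ⟶ Y) (α : Y ⟶ B)
    (γ' : A ⟶ X') (β' : X' ⟶ Y') (α' : Y' ⟶ B)
    (h : γ ≫ β ≫ α = φ) (hγ : IsFrobeniusType toElem γ) (hβ : IsPreStep toElem β)
    (hα : IsPullbackMorphism toElem α)
    (h' : γ' ≫ β' ≫ α' = φ) (hγ' : IsFrobeniusType toElem γ') (hβ' : IsPreStep toElem β')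
    (hα' : IsPullbackMorphism toElem α') :
    ∃ (ε : X ≅ X') (δ : Y ≅ Y'), γ ≫ ε.hom = γ' ∧ β ≫ δ.hom = ε.hom ≫ β' ∧ α = δ.hom ≫ α' := by
  haveI : IsIso α := (isPullbackMorphism_iff α).mp hα
  haveI : IsIso α' := (isPullbackMorphism_iff α').mp hα'
  have hdeg : degFr toElem γ = degFr toElem γ' := by
    have e := congrArg (fun f : A ⟶ B => dg f.1) (h.trans h'.symm)
    have hβ1 : dg β.1 = 1 := hβ.1
    have hβ1' : dg β'.1 = 1 := hβ'.1
    simp only [comp_val, dg_comp, hβ1, hβ1', (dg_dv_of_isIso α).1, (dg_dv_of_isIso α').1, mul_one] at e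
    exact e
  obtain ⟨ε, hε⟩ := ii_unique γ γ' hγ hγ' hdeg
  refine ⟨ε, asIso α ≪≫ (asIso α').symm, hε, ?_, by simp⟩
  haveI := epi γ
  apply (cancel_epi γ).1
  have e1 : γ ≫ β ≫ (asIso α ≪≫ (asIso α').symm).hom = φ ≫ inv α' := by
    rw [← h]; simp
  have e2 : γ ≫ ε.hom ≫ β' = φ ≫ inv α' := by
    rw [← Category.assoc, hε, ← h']; simp
  rw [e1, e2]

/-- (iv)(b): pull-back morphisms (= isomorphisms) are LB-invertible and linear. [cite: MochizukiFrdI2008, Def. 1.3(iv) p.25] -/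
theorem iv_b {A B : Obj} (φ : A ⟶ B) (hφ : IsPullbackMorphism toElem φ) :
    IsLBInvertible toElem φ ∧ IsLinear toElem φ := by
  haveI : IsIso φ := (isPullbackMorphism_iff φ).mp hφ
  obtain ⟨hd, hz⟩ := dg_dv_of_isIso φ
  refine ⟨⟨(isCoAngular_iff φ).mpr ?_, hz⟩, hd⟩
  rintro ⟨rfl, rfl, -⟩; exact not_isIso_low_top φ inferInstance

/-! ### Definition 1.3 (v) -/

/-- (v)(a): pre-steps are monomorphisms. [cite: MochizukiFrdI2008, Def. 1.3(v) p.25] -/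
theorem v_a {A B : Obj} (φ : A ⟶ B) (hφ : IsPreStep toElem φ) : Mono φ := mono_of_linear φ hφ.1

/-- (v)(b), existence: pre-step = isometric pre-step ∘ co-angular pre-step (for a linear
`low → top`: `h_{g'} ∘ (g₀, z, 1)` with `g₀` of the parity of `z`). [cite: MochizukiFrdI2008, Def. 1.3(v) p.25] -/
theorem v_b_exists {A B : Obj} (φ : A ⟶ B) (hφ : IsPreStep toElem φ) :
    ∃ (X : Obj) (β : A ⟶ X) (α : X ⟶ B), β ≫ α = φ ∧ IsCoAngularPreStep toElem β ∧
      (IsIsometry toElem α ∧ IsPreStep toElem α) := by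
  have h1 : dg φ.1 = 1 := hφ.1
  cases A <;> cases B
  · exact ⟨_, φ, 𝟙 _, Category.comp_id φ, isCoAngularPreStep_low φ, rfl, (isPreStep_iff _).mpr rfl⟩
  · obtain ⟨g₀, hg₀⟩ := exists_base_of_par (dv φ.1)
    refine ⟨Obj.low, lowEnd g₀ (dv φ.1) hg₀.symm, hHom (bs φ.1 * g₀⁻¹),
      hom_ext (E_ext ?_ ?_ ?_), isCoAngularPreStep_low _, hHom_isIsometry_isPreStep _⟩
    · simp [hHom]
    · simp [hHom]
    · simp [hHom, h1]
  · exact (no_top_low φ).elim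
  · exact ⟨_, φ, 𝟙 _, Category.comp_id φ, isCoAngularPreStep_top h1, rfl, (isPreStep_iff _).mpr rfl⟩

/-- (v)(b), uniqueness up to an isomorphism of the middle object (when the isometric part is not
invertible — the `low → top` case — the parity pins both factors). [cite: MochizukiFrdI2008, Def. 1.3(v) p.25] -/
theorem v_b_unique {A B X X' : Obj} (φ : A ⟶ B) (β : A ⟶ X) (α : X ⟶ B) (β' : A ⟶ X') (α' : X' ⟶ B)
    (h : β ≫ α = φ) (hβ : IsCoAngularPreStep toElem β) (hα : IsIsometry toElem α ∧ IsPreStep toElem α)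
    (h' : β' ≫ α' = φ) (hβ' : IsCoAngularPreStep toElem β') (hα' : IsIsometry toElem α' ∧ IsPreStep toElem α') :
    ∃ γ : X ≅ X', β ≫ γ.hom = β' ∧ α = γ.hom ≫ α' := by
  obtain ⟨rfl, hβ1⟩ := (isCoAngularPreStep_iff β).mp hβ
  obtain ⟨rfl, hβ1'⟩ := (isCoAngularPreStep_iff β').mp hβ'
  have hαz : dv α.1 = 1 := hα.1
  have hαz' : dv α'.1 = 1 := hα'.1
  have hα1 : dg α.1 = 1 := hα.2.1
  have hα1' : dg α'.1 = 1 := hα'.2.1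
  by_cases hAB : A = B
  · subst hAB
    haveI : IsIso α := (isIso_iff α).mpr ⟨rfl, hα1, hαz⟩
    haveI : IsIso α' := (isIso_iff α').mpr ⟨rfl, hα1', hαz'⟩
    refine ⟨asIso α ≪≫ (asIso α').symm, ?_, by simp⟩
    have e : β ≫ α ≫ inv α' = β' := by rw [← Category.assoc, h, ← h']; simp
    simpa using e
  · cases A <;> cases B
    · exact (hAB rfl).elim
    · -- both factor through `low`; parity forces equality on the nose
      have hdv : dv β.1 = dv β'.1 := by
        have e := congrArg (fun f : Obj.low ⟶ Obj.top => dv f.1) (h.trans h'.symm)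
        simp only [comp_val, dv_comp, hαz, hαz', hα1, hα1', PNat.one_coe, pow_one, one_mul] at e
        exact e
      have hbs : bs β.1 = bs β'.1 := by
        have e := (par_low β).symm.trans (hdv ▸ par_low β')
        exact Multiplicative.toAdd.injective e
      have hββ : β = β' := hom_ext (E_ext hbs hdv (hβ1.trans hβ1'.symm))
      have hbsα : bs α.1 = bs α'.1 := by
        have e := congrArg (fun f : Obj.low ⟶ Obj.top => bs f.1) (h.trans h'.symm)
        simp only [comp_val, bs_comp, hbs] at e
        exact mul_right_cancel e
      refine ⟨Iso.refl _, by rw [Iso.refl_hom, Category.comp_id, hββ], ?_⟩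
      rw [Iso.refl_hom, Category.id_comp]
      exact hom_ext (E_ext hbsα (hαz.trans hαz'.symm) (hα1.trans hα1'.symm))
    · exact (no_top_low φ).elim
    · exact (hAB rfl).elim

/-- (v)(c), existence: pre-step = co-angular pre-step ∘ isometric pre-step (for a linear
`low → top`: `(g, z, 1)_{top} ∘ h₁`). [cite: MochizukiFrdI2008, Def. 1.3(v) p.25] -/
theorem v_c_exists {A B : Obj} (φ : A ⟶ B) (hφ : IsPreStep toElem φ) :
    ∃ (X : Obj) (β' : A ⟶ X) (α' : X ⟶ B), β' ≫ α' = φ ∧ (IsIsometry toElem β' ∧ IsPreStep toElem β') ∧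
      IsCoAngularPreStep toElem α' := by
  have h1 : dg φ.1 = 1 := hφ.1
  cases A <;> cases B
  · exact ⟨_, 𝟙 _, φ, Category.id_comp φ, ⟨rfl, (isPreStep_iff _).mpr rfl⟩, isCoAngularPreStep_low φ⟩
  · refine ⟨Obj.top, hHom 1, toTop Obj.top (bs φ.1) (dv φ.1) 1, hom_ext (E_ext ?_ ?_ ?_),
      hHom_isIsometry_isPreStep 1, isCoAngularPreStep_top rfl⟩
    · simp [hHom]
    · simp [hHom]
    · simp [hHom, h1]
  · exact (no_top_low φ).elim
  · exact ⟨_, 𝟙 _, φ, Category.id_comp φ, ⟨rfl, (isPreStep_iff _).mpr rfl⟩, isCoAngularPreStep_top h1⟩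

/-- (v)(c), uniqueness up to an isomorphism of the middle object. [cite: MochizukiFrdI2008, Def. 1.3(v) p.25] -/
theorem v_c_unique {A B X X' : Obj} (φ : A ⟶ B) (β : A ⟶ X) (α : X ⟶ B) (β' : A ⟶ X') (α' : X' ⟶ B)
    (h : β ≫ α = φ) (hβ : IsIsometry toElem β ∧ IsPreStep toElem β) (hα : IsCoAngularPreStep toElem α)
    (h' : β' ≫ α' = φ) (hβ' : IsIsometry toElem β' ∧ IsPreStep toElem β') (hα' : IsCoAngularPreStep toElem α') :
    ∃ γ : X ≅ X', β ≫ γ.hom = β' ∧ α = γ.hom ≫ α' := by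
  obtain ⟨rfl, hα1⟩ := (isCoAngularPreStep_iff α).mp hα
  obtain ⟨rfl, hα1'⟩ := (isCoAngularPreStep_iff α').mp hα'
  have hβz : dv β.1 = 1 := hβ.1
  have hβz' : dv β'.1 = 1 := hβ'.1
  have hβ1 : dg β.1 = 1 := hβ.2.1
  have hβ1' : dg β'.1 = 1 := hβ'.2.1
  by_cases hAX : A = X'
  · subst hAX
    haveI : IsIso β := (isIso_iff β).mpr ⟨rfl, hβ1, hβz⟩
    haveI : IsIso β' := (isIso_iff β').mpr ⟨rfl, hβ1', hβz'⟩
    refine ⟨(asIso β).symm ≪≫ asIso β', by simp, ?_⟩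
    have e : inv β ≫ β' ≫ α' = α := by rw [h', ← h]; simp
    simpa using e.symm
  · cases A <;> cases X'
    · exact (hAX rfl).elim
    · refine ⟨topAut ((bs β.1)⁻¹ * bs β'.1), hom_ext (E_ext ?_ ?_ ?_), hom_ext (E_ext ?_ ?_ ?_)⟩
      · simp [mul_comm]
      · simp [hβz, hβz']
      · simp [hβ1, hβ1']
      · have e := congrArg (fun f : Obj.low ⟶ Obj.top => bs f.1) (h.trans h'.symm)
        simp only [comp_val, bs_comp] at e
        simp only [comp_val, bs_comp, topAut_hom_val, bs_tr]
        rw [mul_comm ((bs β.1)⁻¹), ← mul_assoc, ← e, mul_assoc, mul_inv_cancel, mul_one]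
      · have e := congrArg (fun f : Obj.low ⟶ Obj.top => dv f.1) (h.trans h'.symm)
        simp only [comp_val, dv_comp, hβz, hβz', one_pow, mul_one] at e
        simp [e, hα1']
      · simp [hα1, hα1']
    · exact (no_top_low β).elim
    · exact (hAX rfl).elim

/-! ### Definition 1.3 (vi), (vii) -/

/-- (vi): base-equivalent, metrically equivalent co-angular pre-steps coincide (unit `1`).
[cite: MochizukiFrdI2008, Def. 1.3(vi) p.25] -/
theorem vi {A B : Obj} (φ ψ : A ⟶ B) (hφ : IsCoAngularPreStep toElem φ) (hψ : IsCoAngularPreStep toElem ψ)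
    (hb : BaseEquivalent toElem φ ψ) (hm : MetricallyEquivalent toElem φ ψ) :
    ∃ α ∈ unitsSubgroup toElem B, ψ ≫ α.hom = φ := by
  have h1 : dg φ.1 = 1 := ((isCoAngularPreStep_iff φ).mp hφ).2
  have h1' : dg ψ.1 = 1 := ((isCoAngularPreStep_iff ψ).mp hψ).2
  refine ⟨1, (unitsSubgroup toElem B).one_mem, ?_⟩
  show ψ ≫ 𝟙 B = φ
  rw [Category.comp_id]
  exact hom_ext (E_ext (hb.symm : bs ψ.1 = bs φ.1) (hm.symm : dv ψ.1 = dv φ.1) (h1'.trans h1.symm))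

/-- (vii)(a): isotropic hulls (`h₁` for `low`, the identity for `top`). [cite: MochizukiFrdI2008, Def. 1.3(vii) p.25] -/
theorem vii_a (A : Obj) : ∃ (B : Obj) (φ : A ⟶ B), IsIsotropicHull toElem φ := by
  cases A
  · exact ⟨Obj.top, hHom 1, isIsotropicHull_hHom⟩
  · refine ⟨Obj.top, 𝟙 _, rfl, (isPreStep_iff _).mpr rfl, isIsotropic_top, fun C' γ _ => ?_⟩
    exact ⟨γ, Category.id_comp γ, fun β hβ => by rw [← hβ, Category.id_comp]⟩

/-- (vii)(b): isotropy propagates along arrows (only `top` is isotropic, and it only maps to `top`).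
[cite: MochizukiFrdI2008, Def. 1.3(vii) p.25] -/
theorem vii_b {A B : Obj} (φ : A ⟶ B) (hA : IsIsotropic toElem A) : IsIsotropic toElem B := by
  cases eq_top_of_isIsotropic hA
  cases B
  · exact (no_top_low φ).elim
  · exact isIsotropic_top

/-! ### Assembly -/

/-- **The two-level category `C → F_Φ` over `B(ℤ/2)` is a Frobenioid** (all of Def. 1.3 verified).
[cite: MochizukiFrdI2008, Def. 1.3 p.24] -/
theorem isFrobenioid : IsFrobenioid toElem where
  isPreFrobenioid := isPreFrobenioid
  i_a := i_a
  i_b := i_b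
  i_c := i_c
  ii_exists := ii_exists
  ii_unique _ _ _ φ ψ hφ hψ hn := ii_unique φ ψ hφ hψ hn
  iii_a _ _ _ f g hf hg := iii_a f g hf hg
  iii_b _ _ φ h ψ := iii_b φ h ψ
  iii_c _ _ φ h := iii_c φ h
  iii_c_base _ _ φ φ' h h' hb α β β' e e' := iii_c_base φ φ' h h' hb α β β' e e'
  iii_d_under_full _ _ _ φ φ' h h' hd := iii_d_under_full φ φ' h h' hd
  iii_d_under_surj := iii_d_under_surj
  iii_d_over_full _ _ _ ψ ψ' h h' hd := iii_d_over_full ψ ψ' h h' hd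
  iii_d_over_surj := iii_d_over_surj
  iv_a_exists _ _ φ := iv_a_exists φ
  iv_a_unique _ _ _ _ _ _ φ γ β α γ' β' α' h hγ hβ hα h' hγ' hβ' hα' :=
    iv_a_unique φ γ β α γ' β' α' h hγ hβ hα h' hγ' hβ' hα'
  iv_b _ _ φ h := iv_b φ h
  v_a _ _ φ h := v_a φ h
  v_b_exists _ _ φ h := v_b_exists φ h
  v_b_unique _ _ _ _ φ β α β' α' h hβ hα h' hβ' hα' := v_b_unique φ β α β' α' h hβ hα h' hβ' hα'
  v_c_exists _ _ φ h := v_c_exists φ h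
  v_c_unique _ _ _ _ φ β α β' α' h hβ hα h' hβ' hα' := v_c_unique φ β α β' α' h hβ hα h' hβ' hα'
  vi _ _ φ ψ hφ hψ hb hm := vi φ ψ hφ hψ hb hm
  vii_a := vii_a
  vii_b _ _ φ h := vii_b φ h

/-- The two-level Frobenioid has an object (`low`) that is metrically trivial but NOT `Aut`-ample
(and not isotropic). [cite: MochizukiFrdI2008, Def. 1.2(iv) p.23] -/
theorem exists_metricallyTrivial_not_autAmple :
    ∃ A : Obj, IsMetricallyTrivial toElem A ∧ ¬ IsAutAmple toElem A ∧ ¬ IsIsotropic toElem A :=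
  ⟨Obj.low, isMetricallyTrivial_low, not_isAutAmple_low, not_isIsotropic_low⟩

end TwoLevel

end Literature.AlgebraicGeometry.Frobenioids
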